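import Mathlib
import HarnessLib
import Literature.NumberTheory.LFunctions.ZetaSubconvexity
import Literature.NumberTheory.LFunctions.BourgainDecouplingMeanValueProofs

/-!
# Bourgain's Theorem 4 (`|S| ≪ M^{1/2} T^{13/84+ε}`, `17/42 ≤ α ≤ 1/2`): the architecture of the
# printed proof, its last step, and the first spacing count of step 3

Topic `Literature/NumberTheory/LFunctions`. Decomposition file for the named fact
`Literature.NumberTheory.LFunctions.Bourgain2017_theorem4_log` (`ZetaSubconvexity.lean`: Bourgain,
*J. Amer. Math. Soc.* **30** (2017), Theorem 4, eq. (3.19), for `F = log`), the one research-level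
input on which the discharge of Bourgain's Theorem 5 `|ζ(1/2 + it)| ≪ t^{13/84+ε}`
(`Literature.NumberTheory.LFunctions.bourgain_subconvexity`) still rests
(`Literature.NumberTheory.LFunctions.bourgain_subconvexity_of_theorem4_of_sargos`,
`ZetaSubconvexityRobertSargos.lean`).

## The printed proof of Theorem 4 (§4 of arXiv:1408.5794 = §3 of the journal version)

Notation (3.1)–(3.3): `F` smooth on `[1/2, 1]` with `min(|F''|, |F'''|, |F''''|) > c`, `c ∈ (0, 1]`;
`T` large, `1 ≤ M ≤ √T`, `f(u) = T F(u/M)`, `S = ∑_{M/2 ≤ m ≤ M} e(f(m))`; a parameter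
`N ∈ (1, M)` and `R = ⌈(2M³/(cNT))^{1/2}⌉` with `R ≤ N ≤ R²`.

1. (3.4)–(3.7): the Bombieri–Iwaniec reduction in the form of Huxley–Watt [H-W] §4 (division into
   length-`N` intervals, rational approximation `a/q` of `f''/2`, cubic Taylor polynomials, Poisson
   summation): either `|S| ≪ M log² N / N^{1/2}` (3.5), or for some `R ≤ Q < R^{2/3} N^{1/3}` (3.6)
   `|S|⁶` is bounded (Hölder) by a bilinear form in `e(x(I)·y(h))` over the minor arcs
   `I ∈ 𝓘(Q, ℓ)` (`#𝓘 ≪ MR²/(NQ²)`, [H-W] Lemma 2.1) and `h ∈ (0, H]⁶`, `H = NQ/R²` (3.7).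
2. (3.8)–(3.9): the double large sieve ([B-I1] Lemma 2.4 = [H-W] Lemma 3.6) bounds its square by
   `A · B₁ · ∏_{j ≤ 4} (X_j Y_j + 1)`, `A` = first spacing count, `B₁` = second spacing count.
3. (3.10): `A ≤ (π⁸/4) A₆(H; δ, Hδ)`, `δ = Q²/(H²R²)` ([H] Lemma 5.6.5), and Corollary 3 of the
   paper (eq. (2.28), `A₆(N, δ, Δ) ≪ δΔN^{9+ε}`; the mean value `A₆` is
   `Literature.NumberTheory.LFunctions.bourgainA6`, `BourgainDecouplingMeanValue.lean`, where (2.28)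
   is an explicit hypothesis — not a separate named fact, its content being part of the present
   obligation — and the form used here is the proved
   `Literature.NumberTheory.LFunctions.Bourgain2017_eq310_of_corollary3`) gives `A ≪ δ² H^{10+ε}` —
   the paper's only new input (`ℓ²`-decoupling, Theorems 1–2).
4. (3.11): Huxley–Watt's second-spacing bound `B₁ ≪ M²R²Q²/N⁶` at `N = MT^{-2/7}`; with 1–3 this is
   (3.12) `|S|⁶ ≪ (M^{6+ε}/N³)(N/R)` and, by (3.3), `|S|⁶ ≪ M^{3+ε} T^{13/14}`, i.e.
   **(3.13)** `|S| ≪ M^{1/2} T^{ε+13/84}` for `√T ≥ M ≥ cT^{3/7}`.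
5. (3.14)–(3.17): Huxley's refinement ([H1] §7: the factor `V`, resonance curves) of the second
   spacing problem, (3.15), optimised in `N` (`N = max(MT^{-17/57}, M^{1/2}T^{-1/12})` for
   `M ≥ T^{5/12}`, `N = (2M³/(cT))^{1/2}` below), gives **(3.18)**:
   `|S|⁶ ≪ M^{3+ε} T^{53/57}` (`√T ≥ M > T^{49/114}`), `M^{4+ε} T^{1/2}` (`T^{49/114} ≥ M ≥ T^{5/12}`),
   `M^{2+ε} T^{4/3}` (`T^{5/12} > M ≥ 2(cT)^{1/3}`).
6. **Theorem 4** (3.19): "Using (3.18) if `M < T^{3/7}` (noting the inequalities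
   `49/114 > 3/7 > 5/12`), one verifies that the bound on `|S|` in (3.13) holds if
   `√T ≥ M ≥ T^{17/42}`": `M^{4+ε} T^{1/2} ≤ M³ T^{13/14+ε}` iff `M^{1+ε} ≤ T^{3/7+ε}`, and
   `M^{2+ε} T^{4/3} ≤ M^{3+ε} T^{13/14}` iff `T^{17/42} ≤ M` (`4/3 - 13/14 = 17/42`).

## Content (this file: step 6 and the counting half of step 3, PROVED)

Step 6, with its two inputs as explicit hypotheses:

* `Literature.NumberTheory.LFunctions.pow_six_sqrt_mul_rpow` — PROVED: `(K √M T^{13/84+ε})⁶ =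
  K⁶ M³ T^{13/14+6ε}`.
* `Literature.NumberTheory.LFunctions.Bourgain2017_theorem4_log_of_eq313_of_eq318` — PROVED:
  Theorem 4 for `F = log` from (3.13) (hypothesis `h313`, on `T^{3/7} ≤ M ≤ √T`) and cases 2–3 of
  (3.18) (hypothesis `h318`; case 1, `M > T^{49/114}`, is not used in step 6): (3.13) on
  `[T^{3/7}, √T]`, case 2 of (3.18) on `[T^{5/12}, T^{3/7})`, case 3 on `[T^{17/42}, T^{5/12})`,
  where `2T^{1/3} ≤ T^{17/42}` as soon as `T ≥ 2^{14}`.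

Step 3 (the display before (3.10) and (3.10) itself, p. 11 of the paper): the first spacing count
`A` of the double large sieve (3.8)–(3.9) is dominated by the twelfth moment `A₆` of (2.28)
(`Literature.NumberTheory.LFunctions.bourgainA6`, `BourgainDecouplingMeanValue.lean`):

* `Literature.NumberTheory.LFunctions.bourgainFirstSpacingCount H δ Δ` — DEFINITION: the number
  `A` of pairs `(h, h') ∈ ((0, H]⁶)²` with `|yⱼ(h) - yⱼ(h')| < 1/(2Xⱼ)` (`j ≤ 4`),
  `y(h) = ∑ᵢ (hᵢ, hᵢ², hᵢ^{3/2}, hᵢ^{1/2})`, written in the normalisation of (2.28)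
  (`X₁ = X₂ = 1/2`; the last two conditions as `|∑(hᵢ/H)^{3/2} - ∑(h'ᵢ/H)^{3/2}| < δ/2`,
  `|∑(hᵢ/H)^{1/2} - ∑(h'ᵢ/H)^{1/2}| < Δ/2`, which for `X₃ = X₄ = δ⁻¹H^{-3/2}`, `Δ = Hδ` — in the
  paper `δ = Q²/(H²R²)`, `X₃ = X₄ = (R/Q)² H^{1/2}` — are the printed ones); with
  `Literature.NumberTheory.LFunctions.bourgainSixFreq` (the frequency vector of a six-tuple) and
  `Literature.NumberTheory.LFunctions.bourgainPairWeight` (the weight of a pair after integration).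
* `Literature.NumberTheory.LFunctions.bourgainFirstSpacingCount_le` — PROVED:
  `A ≤ (π⁴/16) A₆(H; δ, Δ)` for all `H` and `δ, Δ > 0` (the paper: "it is a corollary of [H],
  Lemma 5.6.5 (for example) that we have here `0 ≤ A ≤ … = (π⁸/4) A₆(H; δ, Hδ)`"). Proof: insert
  the weight `(1 - |x₃|)(1 - |x₄|) ≤ 1` into `A₆ = ∫_{[0,1]²×[-1,1]²} |S|¹²`, expand `|S|¹² = |S⁶|²`
  as the double sum over `(h, h')` of `e((freq h - freq h')·x)`
  (`Literature.NumberTheory.LFunctions.norm_bourgainA6Sum_pow_twelve`) and integrate coordinatewise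
  (`Literature.NumberTheory.LFunctions.setIntegral_Icc_pi_prod`): the integer frequencies in
  `x₁, x₂` give the orthogonality factors `[∑hᵢ = ∑h'ᵢ][∑hᵢ² = ∑h'ᵢ²] ≥ 0`
  (`Literature.NumberTheory.LFunctions.intervalIntegral_cexp_two_pi_mul_int`), the real ones in
  `x₃, x₄` the Fejér factors `𝔉(u) = ∫₋₁¹ (1 - |y|) e(uy) dy = (sin πu/(πu))² ≥ 0`
  (`Literature.NumberTheory.LFunctions.fejerKernelValue`,
  `Literature.NumberTheory.LFunctions.intervalIntegral_fejerKernelValue`), and for a close pair the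
  four factors are `≥ 1, 1, 4/π², 4/π²` (Jordan's inequality,
  `Literature.NumberTheory.LFunctions.fejerKernelValue_ge`).
* `Literature.NumberTheory.LFunctions.Bourgain2017_eq310_count_of_corollary3` — PROVED: (3.10)
  for the count, `A ≤ C(ε) δ² H^{10+ε}` for `H ≥ 1`, `1/H² ≤ δ ≤ 1/H`, from Corollary 3 (2.28) of
  the paper as an explicit hypothesis (via
  `Literature.NumberTheory.LFunctions.Bourgain2017_eq310_of_corollary3`).

No new named fact is introduced (D-0026): (3.13) and (3.18) are intermediate displays of the
paper resting on the whole Bombieri–Iwaniec–Huxley–Watt machinery (steps 1–5: [H-W] §§2–4, [H1]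
§7, [H] Chs. 5, 7–17, none of it in Mathlib or in this tree), so they enter only as hypotheses of
the proved step 6; the decoupling input of step 3 (Corollary 3, (2.28)) is an explicit hypothesis
of `Bourgain2017_eq310_count_of_corollary3`, the mean value `A₆` and the reductions around it being
in `BourgainDecouplingMeanValue.lean`. What remains unformalised of step 3 is thus exactly (2.28)
(the paper's `ℓ²`-decoupling Theorems 1–2); of steps 1, 2, 4, 5 everything.

## Faithfulness notes

* As in `ZetaSubconvexity.lean`: Bourgain's `T` is `t/2π`, `m ∼ M` is `M/2 ≤ m ≤ M`
  (`Literature.NumberTheory.LFunctions.bourgainSum`), `≪` with "`T` sufficiently large" is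
  `∀ ε > 0, ∃ C T₀, ∀ T ≥ T₀, …` (implied constants depend on `ε`, and on `c`, `F`, here fixed).
* For `F = log` condition (3.1) holds with every `c ∈ (0, 1)` (`|F''| ≥ 1`, `|F'''| ≥ 2`,
  `|F''''| ≥ 6` on `[1/2, 1]`). (3.13) is printed for `√T ≥ M ≥ cT^{3/7}` and case 3 of (3.18) for
  `M ≥ 2(cT)^{1/3}`; the hypotheses `h313`, `h318` ask for them only on the narrower ranges
  `M ≥ T^{3/7}` and `M ≥ 2T^{1/3}` (`c ≤ 1`), which is weaker than what the paper proves and all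
  that step 6 uses.
* (3.18) bounds `|S|⁶`; it is written for `‖S‖ ^ 6` with the printed exponents `M^{k+ε}` on `M`.
* Step 3: the paper bounds `A` through [H] Lemma 5.6.5 with the constant `(π²/2)⁴ · 4 = π⁸/4`
  (Huxley's lemma is stated for the weaker closeness `|y - y'| < 1/X`); the proof here treats the
  two integer coordinates by orthogonality over the full period `[0, 1]` and only `x₃, x₄` by the
  Fejér kernel, which gives the (better, equally inessential) constant `(π²/4)² = π⁴/16`. The count
  `A` is the printed one (strict inequalities `< 1/(2Xⱼ)`, ordered pairs, `h, h' ∈ (0, H]⁶` with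
  repetitions), in the normalised coordinates of (2.28) as explained at
  `Literature.NumberTheory.LFunctions.bourgainFirstSpacingCount`; the identity of normalisations
  `(π²/2)⁴ (X₁X₂X₃X₄)⁻¹ ∫_{∏[-Xⱼ,Xⱼ]} |∑ₕ e(y(h)·z)|² dz = (π⁸/4) A₆(H; δ, Hδ)` printed on p. 11 is
  the substitution `z₃ = X₃x₃`, `z₄ = X₄x₄` and is not needed here.

## References

* J. Bourgain, *Decoupling, exponential sums and the Riemann zeta function*, J. Amer. Math. Soc.
  30 (2017), 205–224, doi:10.1090/jams/860, arXiv:1408.5794 — §4: (3.1)–(3.19), Theorem 4.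
* [H-W] M. N. Huxley, N. Watt, *Exponential sums and the Riemann zeta function*, Proc. London
  Math. Soc. (3) 57 (1988), 1–24, doi:10.1112/plms/s3-57.1.1 — §4 (the reduction), Lemma 2.1,
  Lemma 3.4, Lemma 3.6 (double large sieve), the second spacing problem.
* [H1] M. N. Huxley, *Exponential sums and the Riemann zeta function IV*, Proc. London Math. Soc.
  (3) 66 (1993), 1–40 — §§7–8 (resonance curves; the choice of `N`).
* [H] M. N. Huxley, *Area, Lattice Points and Exponential Sums*, LMS Monographs 13, Oxford 1996 —
  Lemma 5.6.5, the first and second spacing problems.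
* [B-I1] E. Bombieri, H. Iwaniec, *On the order of `ζ(1/2 + it)`*, Ann. Sc. Norm. Sup. Pisa 13
  (1986), 449–472 — Lemma 2.4.
-/

noncomputable section

open Complex Finset
open scoped Real

namespace Literature.NumberTheory.LFunctions

/-! ## Step 6: Theorem 4 from (3.13) and (3.18) -/

/-- The sixth power of the target bound: `(K √M T^{13/84+ε})⁶ = K⁶ M³ T^{13/14 + 6ε}` for `M ≥ 0`,
`T ≥ 0`. [folklore] -/
theorem pow_six_sqrt_mul_rpow {K M T ε : ℝ} (hM : 0 ≤ M) (hT : 0 ≤ T) :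
    (K * Real.sqrt M * T ^ (13 / 84 + ε)) ^ 6 = K ^ 6 * M ^ 3 * T ^ (13 / 14 + 6 * ε) := by
  have h1 : Real.sqrt M ^ 6 = M ^ 3 := by
    rw [show (6 : ℕ) = 2 * 3 from rfl, pow_mul, Real.sq_sqrt hM]
  have h2 : (T ^ (13 / 84 + ε)) ^ 6 = T ^ (13 / 14 + 6 * ε) := by
    rw [← Real.rpow_mul_natCast hT]
    congr 1
    push_cast
    ring
  rw [mul_pow, mul_pow, h1, h2]

/-- **Bourgain 2017, Theorem 4 for `F = log`, from (3.13) and (3.18)** (the last step of the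
printed proof: "Using (3.18) if `M < T^{3/7}` (noting the inequalities `49/114 > 3/7 > 5/12`), one
verifies that the bound on `|S|` in (3.13) holds if `√T ≥ M ≥ T^{17/42}`. Thus we establish
Theorem 4."). The hypotheses are, for `S = ∑_{M/2 ≤ m ≤ M} e(T log(m/M))` and in the
`∀ ε > 0, ∃ C T₀, ∀ T ≥ T₀` rendering of `≪`:
* `h313` = (3.13) "`|S| ≪ M^{1/2} T^{ε+13/84}` for `√T ≥ M ≥ cT^{3/7}`", asked only on
  `T^{3/7} ≤ M ≤ √T`;
* `h318` = cases 2 and 3 of (3.18) "`|S|⁶ ≪ M^{4+ε} T^{1/2}` if `T^{49/114} ≥ M ≥ T^{5/12}`;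
  `M^{2+ε} T^{4/3}` if `T^{5/12} > M ≥ 2(cT)^{1/3}`", the latter asked only from `2T^{1/3}`.
On `[T^{3/7}, √T]` the conclusion is (3.13); on `[T^{5/12}, T^{3/7})` case 2 gives
`‖S‖⁶ ≪ M^{4+ε} T^{1/2} ≤ M³ T^{13/14 + 6ε}` (as `M^{1+ε} ≤ T^{3/7} T^{6ε}`); on
`[T^{17/42}, T^{5/12})` (where `2T^{1/3} ≤ T^{17/42}` once `T ≥ 2^{14}`) case 3 gives
`‖S‖⁶ ≪ M^{2+ε} T^{4/3} = M^{2+ε} T^{17/42} T^{13/14} ≤ M³ T^{13/14 + 6ε}`; and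
`M³ T^{13/14+6ε} = (M^{1/2} T^{13/84+ε})⁶`.
[cite: BourgainJAMS2017, Theorem 4, eq. (3.19); §4 eq. (3.13), (3.18)] -/
theorem Bourgain2017_theorem4_log_of_eq313_of_eq318
    (h313 : ∀ ε : ℝ, 0 < ε → ∃ C T₀ : ℝ, ∀ T : ℝ, T₀ ≤ T → ∀ M : ℝ,
      T ^ (3 / 7 : ℝ) ≤ M → M ≤ Real.sqrt T →
        ‖bourgainSum Real.log T M‖ ≤ C * Real.sqrt M * T ^ (13 / 84 + ε))
    (h318 : ∀ ε : ℝ, 0 < ε → ∃ C T₀ : ℝ, ∀ T : ℝ, T₀ ≤ T → ∀ M : ℝ,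
      (T ^ (5 / 12 : ℝ) ≤ M → M ≤ T ^ (49 / 114 : ℝ) →
          ‖bourgainSum Real.log T M‖ ^ 6 ≤ C * M ^ (4 + ε) * T ^ (1 / 2 : ℝ)) ∧
      (2 * T ^ (1 / 3 : ℝ) ≤ M → M < T ^ (5 / 12 : ℝ) →
          ‖bourgainSum Real.log T M‖ ^ 6 ≤ C * M ^ (2 + ε) * T ^ (4 / 3 : ℝ))) :
    Bourgain2017_theorem4_log := by
  intro ε hε
  obtain ⟨C₁, T₁, H₁⟩ := h313 ε hε
  obtain ⟨C₂, T₂, H₂⟩ := h318 ε hε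
  set K : ℝ := max 1 |C₂| with hK
  refine ⟨|C₁| + K, max (max T₁ T₂) (2 ^ 14), ?_⟩
  intro T hT M hMl hMu
  have hT₁ : T₁ ≤ T := le_trans ((le_max_left _ _).trans (le_max_left _ _)) hT
  have hT₂ : T₂ ≤ T := le_trans ((le_max_right _ _).trans (le_max_left _ _)) hT
  have hT14 : (2 : ℝ) ^ 14 ≤ T := le_trans (le_max_right _ _) hT
  have hT1 : (1 : ℝ) ≤ T := le_trans (by norm_num) hT14
  have hTpos : (0 : ℝ) < T := by linarith
  have hM1 : (1 : ℝ) ≤ M := le_trans (Real.one_le_rpow hT1 (by norm_num)) hMl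
  have hMpos : (0 : ℝ) < M := by linarith
  have hMT : M ≤ T := by
    refine hMu.trans ?_
    calc Real.sqrt T ≤ Real.sqrt (T ^ 2) := Real.sqrt_le_sqrt (by nlinarith)
      _ = T := Real.sqrt_sq hTpos.le
  have hK1 : 1 ≤ K := le_max_left _ _
  have hKC : |C₂| ≤ K := le_max_right _ _
  have hK0 : 0 ≤ K := zero_le_one.trans hK1
  have hY : 0 ≤ Real.sqrt M * T ^ (13 / 84 + ε) := by positivity
  by_cases hA : T ^ (3 / 7 : ℝ) ≤ M
  · -- (3.13) on `T^{3/7} ≤ M ≤ √T`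
    calc ‖bourgainSum Real.log T M‖ ≤ C₁ * Real.sqrt M * T ^ (13 / 84 + ε) := H₁ T hT₁ M hA hMu
      _ = C₁ * (Real.sqrt M * T ^ (13 / 84 + ε)) := by ring
      _ ≤ |C₁| * (Real.sqrt M * T ^ (13 / 84 + ε)) :=
          mul_le_mul_of_nonneg_right (le_abs_self _) hY
      _ ≤ (|C₁| + K) * (Real.sqrt M * T ^ (13 / 84 + ε)) :=
          mul_le_mul_of_nonneg_right (by linarith) hY
      _ = (|C₁| + K) * Real.sqrt M * T ^ (13 / 84 + ε) := by ring
  · -- (3.18) on `T^{17/42} ≤ M < T^{3/7}`: bound `‖S‖⁶` by `(K √M T^{13/84+ε})⁶`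
    rw [not_le] at hA
    suffices h6 : ‖bourgainSum Real.log T M‖ ^ 6 ≤ (K * Real.sqrt M * T ^ (13 / 84 + ε)) ^ 6 by
      have hKY : 0 ≤ K * Real.sqrt M * T ^ (13 / 84 + ε) := by positivity
      have h := (pow_le_pow_iff_left₀ (norm_nonneg _) hKY (by norm_num : (6 : ℕ) ≠ 0)).1 h6
      calc ‖bourgainSum Real.log T M‖ ≤ K * Real.sqrt M * T ^ (13 / 84 + ε) := h
        _ = K * (Real.sqrt M * T ^ (13 / 84 + ε)) := by ring
        _ ≤ (|C₁| + K) * (Real.sqrt M * T ^ (13 / 84 + ε)) :=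
            mul_le_mul_of_nonneg_right (by linarith [abs_nonneg C₁]) hY
        _ = (|C₁| + K) * Real.sqrt M * T ^ (13 / 84 + ε) := by ring
    rw [pow_six_sqrt_mul_rpow hMpos.le hTpos.le]
    have hMε : M ^ ε ≤ T ^ (6 * ε) :=
      calc M ^ ε ≤ T ^ ε := Real.rpow_le_rpow hMpos.le hMT hε.le
        _ ≤ T ^ (6 * ε) := Real.rpow_le_rpow_of_exponent_le hT1 (by linarith)
    have hK6 : K ≤ K ^ 6 := le_self_pow₀ hK1 (by norm_num)
    obtain ⟨H₂b, H₂c⟩ := H₂ T hT₂ M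
    by_cases hB : T ^ (5 / 12 : ℝ) ≤ M
    · -- case 2 of (3.18): `M^{4+ε} T^{1/2} ≤ M³ T^{13/14+6ε}` since `M < T^{3/7}`
      have hM49 : M ≤ T ^ (49 / 114 : ℝ) :=
        hA.le.trans (Real.rpow_le_rpow_of_exponent_le hT1 (by norm_num))
      have key : M ^ (4 + ε) * T ^ (1 / 2 : ℝ) ≤ M ^ 3 * T ^ (13 / 14 + 6 * ε) := by
        have e1 : M ^ (4 + ε) = M ^ 3 * (M * M ^ ε) := by
          rw [show (4 + ε) = ((3 : ℕ) : ℝ) + (1 + ε) by push_cast; ring, Real.rpow_add hMpos,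
            Real.rpow_natCast, Real.rpow_add hMpos, Real.rpow_one]
        have e2 : T ^ (13 / 14 + 6 * ε) = T ^ (3 / 7 : ℝ) * T ^ (6 * ε) * T ^ (1 / 2 : ℝ) := by
          rw [← Real.rpow_add hTpos, ← Real.rpow_add hTpos]
          congr 1
          ring
        have h3 : M * M ^ ε ≤ T ^ (3 / 7 : ℝ) * T ^ (6 * ε) :=
          mul_le_mul hA.le hMε (by positivity) (by positivity)
        rw [e1, e2]
        calc M ^ 3 * (M * M ^ ε) * T ^ (1 / 2 : ℝ)
            ≤ M ^ 3 * (T ^ (3 / 7 : ℝ) * T ^ (6 * ε)) * T ^ (1 / 2 : ℝ) :=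
              mul_le_mul_of_nonneg_right (mul_le_mul_of_nonneg_left h3 (by positivity))
                (by positivity)
          _ = M ^ 3 * (T ^ (3 / 7 : ℝ) * T ^ (6 * ε) * T ^ (1 / 2 : ℝ)) := by ring
      calc ‖bourgainSum Real.log T M‖ ^ 6 ≤ C₂ * M ^ (4 + ε) * T ^ (1 / 2 : ℝ) := H₂b hB hM49
        _ = C₂ * (M ^ (4 + ε) * T ^ (1 / 2 : ℝ)) := by ring
        _ ≤ K * (M ^ (4 + ε) * T ^ (1 / 2 : ℝ)) :=
            mul_le_mul_of_nonneg_right ((le_abs_self _).trans hKC) (by positivity)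
        _ ≤ K * (M ^ 3 * T ^ (13 / 14 + 6 * ε)) := mul_le_mul_of_nonneg_left key hK0
        _ ≤ K ^ 6 * (M ^ 3 * T ^ (13 / 14 + 6 * ε)) :=
            mul_le_mul_of_nonneg_right hK6 (by positivity)
        _ = K ^ 6 * M ^ 3 * T ^ (13 / 14 + 6 * ε) := by ring
    · -- case 3 of (3.18): `M^{2+ε} T^{4/3} ≤ M³ T^{13/14+6ε}` since `T^{17/42} ≤ M`
      rw [not_le] at hB
      have h2M : 2 * T ^ (1 / 3 : ℝ) ≤ M := by
        have h2 : (2 : ℝ) ≤ T ^ (1 / 14 : ℝ) := by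
          calc (2 : ℝ) = ((2 : ℝ) ^ (14 : ℝ)) ^ (1 / 14 : ℝ) := by
                rw [← Real.rpow_mul (by norm_num)]
                norm_num
            _ = ((2 : ℝ) ^ 14) ^ (1 / 14 : ℝ) := by
                rw [show (14 : ℝ) = ((14 : ℕ) : ℝ) by norm_num, Real.rpow_natCast]
            _ ≤ T ^ (1 / 14 : ℝ) := Real.rpow_le_rpow (by norm_num) hT14 (by norm_num)
        calc 2 * T ^ (1 / 3 : ℝ) ≤ T ^ (1 / 14 : ℝ) * T ^ (1 / 3 : ℝ) :=
              mul_le_mul_of_nonneg_right h2 (by positivity)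
          _ = T ^ (17 / 42 : ℝ) := by
              rw [← Real.rpow_add hTpos]
              norm_num
          _ ≤ M := hMl
      have key : M ^ (2 + ε) * T ^ (4 / 3 : ℝ) ≤ M ^ 3 * T ^ (13 / 14 + 6 * ε) := by
        have e1 : M ^ (2 + ε) = M ^ 2 * M ^ ε := by
          rw [show (2 + ε) = ((2 : ℕ) : ℝ) + ε by push_cast; ring, Real.rpow_add hMpos,
            Real.rpow_natCast]
        have e2 : T ^ (4 / 3 : ℝ) = T ^ (17 / 42 : ℝ) * T ^ (13 / 14 : ℝ) := by
          rw [← Real.rpow_add hTpos]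
          norm_num
        have e3 : T ^ (13 / 14 + 6 * ε) = T ^ (6 * ε) * T ^ (13 / 14 : ℝ) := by
          rw [← Real.rpow_add hTpos]
          congr 1
          ring
        rw [e1, e2, e3]
        calc M ^ 2 * M ^ ε * (T ^ (17 / 42 : ℝ) * T ^ (13 / 14 : ℝ))
            ≤ M ^ 2 * T ^ (6 * ε) * (M * T ^ (13 / 14 : ℝ)) :=
              mul_le_mul (mul_le_mul_of_nonneg_left hMε (by positivity))
                (mul_le_mul_of_nonneg_right hMl (by positivity)) (by positivity) (by positivity)
          _ = M ^ 3 * (T ^ (6 * ε) * T ^ (13 / 14 : ℝ)) := by ring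
      calc ‖bourgainSum Real.log T M‖ ^ 6 ≤ C₂ * M ^ (2 + ε) * T ^ (4 / 3 : ℝ) := H₂c h2M hB
        _ = C₂ * (M ^ (2 + ε) * T ^ (4 / 3 : ℝ)) := by ring
        _ ≤ K * (M ^ (2 + ε) * T ^ (4 / 3 : ℝ)) :=
            mul_le_mul_of_nonneg_right ((le_abs_self _).trans hKC) (by positivity)
        _ ≤ K * (M ^ 3 * T ^ (13 / 14 + 6 * ε)) := mul_le_mul_of_nonneg_left key hK0
        _ ≤ K ^ 6 * (M ^ 3 * T ^ (13 / 14 + 6 * ε)) :=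
            mul_le_mul_of_nonneg_right hK6 (by positivity)
        _ = K ^ 6 * M ^ 3 * T ^ (13 / 14 + 6 * ε) := by ring

/-! ## Step 3: the first spacing count `A ≤ (π⁴/16) A₆(H; δ, Δ)` and (3.10)

The double large sieve (3.8) bounds the bilinear form of (3.7) by `A · B₁ · ∏ⱼ (XⱼYⱼ + 1)`, where
`A` counts the pairs `(h, h') ∈ ((0, H]⁶)²` whose vectors `y(h) = ∑ᵢ (hᵢ, hᵢ², hᵢ^{3/2}, hᵢ^{1/2})`
are close, `|yⱼ(h) - yⱼ(h')| < 1/(2Xⱼ)` (`X₁ = X₂ = 1/2`, `X₃ = X₄ = (R/Q)²H^{1/2}`). The paper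
bounds `A` by the Fejér-kernel majorant ([H] Lemma 5.6.5) and rescales to
`A ≤ (π⁸/4) A₆(H; δ, Hδ)`, `δ = Q²/(H²R²)`; then Corollary 3 gives (3.10) `A ≪ δ²H^{10+ε}`. Below,
the count is written directly in the normalised coordinates of (2.28) and bounded by
`(π⁴/16) A₆(H; δ, Δ)` for any `δ, Δ > 0`. -/

open MeasureTheory intervalIntegral

/-! ### One-dimensional kernels: orthogonality on `[0,1]` and the Fejér kernel on `[-1,1]` -/

/-- Orthogonality: `∫₀¹ e(m y) dy = [m = 0]` for an integer `m`. [folklore] -/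
theorem intervalIntegral_cexp_two_pi_mul_int (m : ℤ) :
    ∫ y in (0 : ℝ)..1, Complex.exp (2 * π * I * m * y) = if m = 0 then 1 else 0 := by
  split_ifs with hm
  · simp [hm]
  · have hc : (2 * π * I * m : ℂ) ≠ 0 := by
      have hπ : (π : ℂ) ≠ 0 := by exact_mod_cast Real.pi_ne_zero
      have hm' : (m : ℂ) ≠ 0 := by exact_mod_cast hm
      simp [hπ, hm', I_ne_zero]
    have key := integral_exp_mul_complex (a := (0 : ℝ)) (b := 1) hc
    have e1 : Complex.exp (2 * π * I * m) = 1 := by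
      rw [show (2 * π * I * m : ℂ) = m * (2 * π * I) by ring]
      exact Complex.exp_int_mul_two_pi_mul_I m
    simp only [ofReal_one, mul_one, ofReal_zero, mul_zero, Complex.exp_zero, e1, sub_self,
      zero_div] at key
    exact key

/-- `∫₀¹ (1 - y) e^{c y} dy = (e^c - 1 - c) / c²` for `c ≠ 0`. [folklore] -/
theorem intervalIntegral_one_sub_mul_cexp {c : ℂ} (hc : c ≠ 0) :
    ∫ y in (0 : ℝ)..1, (1 - (y : ℂ)) * Complex.exp (c * y) =
      (Complex.exp c - 1 - c) / c ^ 2 := by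
  have hc2 : c ^ 2 ≠ 0 := pow_ne_zero 2 hc
  have hderiv : ∀ y ∈ Set.uIcc (0 : ℝ) 1,
      HasDerivAt
        (fun y : ℝ => (1 - (y : ℂ)) * Complex.exp (c * y) / c + Complex.exp (c * y) / c ^ 2)
        ((1 - (y : ℂ)) * Complex.exp (c * y)) y := by
    intro y _
    have h1 : HasDerivAt
        (fun w : ℂ => (1 - w) * Complex.exp (c * w) / c + Complex.exp (c * w) / c ^ 2)
        ((1 - (y : ℂ)) * Complex.exp (c * y)) (y : ℂ) := by
      have he : HasDerivAt (fun w : ℂ => Complex.exp (c * w)) (Complex.exp (c * y) * c)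
          (y : ℂ) := by
        have := ((hasDerivAt_id (y : ℂ)).const_mul c).cexp
        simpa using this
      have hl : HasDerivAt (fun w : ℂ => (1 - w)) (-1) (y : ℂ) := by
        simpa using (hasDerivAt_id (y : ℂ)).const_sub 1
      have hsum := ((hl.mul he).div_const c).add (he.div_const (c ^ 2))
      refine hsum.congr_deriv ?_
      rw [div_add_div _ _ hc hc2, div_eq_iff (mul_ne_zero hc hc2)]
      ring
    exact h1.comp_ofReal
  have hint : IntervalIntegrable (fun y : ℝ => (1 - (y : ℂ)) * Complex.exp (c * y)) volume 0 1 := by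
    apply Continuous.intervalIntegrable
    fun_prop
  rw [intervalIntegral.integral_eq_sub_of_hasDerivAt hderiv hint]
  simp only [ofReal_one, sub_self, zero_mul, zero_div, zero_add, mul_one, ofReal_zero, sub_zero,
    mul_zero, Complex.exp_zero]
  rw [div_add_div _ _ hc hc2, div_sub_div _ _ hc2 (mul_ne_zero hc hc2),
    div_eq_div_iff (mul_ne_zero hc2 (mul_ne_zero hc hc2)) hc2]
  ring

/-- `∫₋₁⁰ (1 + y) e^{c y} dy = (e^{-c} - 1 + c) / c²` for `c ≠ 0`. [folklore] -/
theorem intervalIntegral_one_add_mul_cexp {c : ℂ} (hc : c ≠ 0) :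
    ∫ y in (-1 : ℝ)..0, (1 + (y : ℂ)) * Complex.exp (c * y) =
      (Complex.exp (-c) - 1 + c) / c ^ 2 := by
  have h := intervalIntegral_one_sub_mul_cexp (neg_ne_zero.2 hc)
  have hneg := intervalIntegral.integral_comp_neg (a := (-1 : ℝ)) (b := 0)
    (f := fun y : ℝ => (1 - (y : ℂ)) * Complex.exp (-c * y))
  simp only [neg_neg, neg_zero] at hneg
  rw [h] at hneg
  have e : (fun y : ℝ => (1 + (y : ℂ)) * Complex.exp (c * y)) =
      fun y : ℝ => (1 - ((-y : ℝ) : ℂ)) * Complex.exp (-c * ((-y : ℝ) : ℂ)) := by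
    ext y
    push_cast
    ring_nf
  rw [e, hneg, neg_sq]
  ring

/-- The Fejér integral `∫₋₁¹ (1 - |y|) e^{c y} dy = (e^c + e^{-c} - 2) / c²` for `c ≠ 0`.
[folklore] -/
theorem intervalIntegral_fejer_cexp {c : ℂ} (hc : c ≠ 0) :
    ∫ y in (-1 : ℝ)..1, ((1 - |y| : ℝ) : ℂ) * Complex.exp (c * y) =
      (Complex.exp c + Complex.exp (-c) - 2) / c ^ 2 := by
  have hcont : Continuous fun y : ℝ => ((1 - |y| : ℝ) : ℂ) * Complex.exp (c * y) := by fun_prop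
  rw [← intervalIntegral.integral_add_adjacent_intervals (b := 0) (hcont.intervalIntegrable _ _)
    (hcont.intervalIntegrable _ _)]
  have h1 : ∫ y in (-1 : ℝ)..0, ((1 - |y| : ℝ) : ℂ) * Complex.exp (c * y) =
      ∫ y in (-1 : ℝ)..0, (1 + (y : ℂ)) * Complex.exp (c * y) := by
    apply intervalIntegral.integral_congr
    intro y hy
    rw [Set.uIcc_of_le (by norm_num)] at hy
    simp only [abs_of_nonpos hy.2]
    push_cast
    ring
  have h2 : ∫ y in (0 : ℝ)..1, ((1 - |y| : ℝ) : ℂ) * Complex.exp (c * y) =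
      ∫ y in (0 : ℝ)..1, (1 - (y : ℂ)) * Complex.exp (c * y) := by
    apply intervalIntegral.integral_congr
    intro y hy
    rw [Set.uIcc_of_le (by norm_num)] at hy
    simp only [abs_of_nonneg hy.1, ofReal_sub, ofReal_one]
  rw [h1, h2, intervalIntegral_one_add_mul_cexp hc, intervalIntegral_one_sub_mul_cexp hc]
  ring

/-- `∫₋₁¹ (1 - |y|) dy = 1`. [folklore] -/
theorem intervalIntegral_one_sub_abs : ∫ y in (-1 : ℝ)..1, (1 - |y|) = 1 := by
  have hcont : Continuous fun y : ℝ => 1 - |y| := by fun_prop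
  rw [← intervalIntegral.integral_add_adjacent_intervals (b := 0) (hcont.intervalIntegrable _ _)
    (hcont.intervalIntegrable _ _)]
  have h1 : ∫ y in (-1 : ℝ)..0, (1 - |y|) = ∫ y in (-1 : ℝ)..0, ((1 : ℝ) + y) := by
    apply intervalIntegral.integral_congr
    intro y hy
    rw [Set.uIcc_of_le (by norm_num)] at hy
    simp [abs_of_nonpos hy.2]
  have h2 : ∫ y in (0 : ℝ)..1, (1 - |y|) = ∫ y in (0 : ℝ)..1, ((1 : ℝ) - y) := by
    apply intervalIntegral.integral_congr
    intro y hy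
    rw [Set.uIcc_of_le (by norm_num)] at hy
    simp [abs_of_nonneg hy.1]
  have i1 : IntervalIntegrable (fun y : ℝ => (1 : ℝ)) volume (-1) 0 := intervalIntegrable_const
  have i2 : IntervalIntegrable (fun y : ℝ => y) volume (-1) 0 :=
    (continuous_id : Continuous fun y : ℝ => y).intervalIntegrable _ _
  have i3 : IntervalIntegrable (fun y : ℝ => (1 : ℝ)) volume 0 1 := intervalIntegrable_const
  have i4 : IntervalIntegrable (fun y : ℝ => y) volume 0 1 :=
    (continuous_id : Continuous fun y : ℝ => y).intervalIntegrable _ _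
  rw [h1, h2, intervalIntegral.integral_add i1 i2, intervalIntegral.integral_sub i3 i4]
  simp only [intervalIntegral.integral_const, integral_id]
  norm_num

/-- The Fejér kernel value `𝔉(u) = ∫₋₁¹ (1 - |y|) e(u y) dy` in closed form:
`𝔉(0) = 1`, `𝔉(u) = (1 - cos 2πu)/(2π²u²) = (sin πu / (πu))²` for `u ≠ 0`. [folklore] -/
def fejerKernelValue (u : ℝ) : ℝ :=
  if u = 0 then 1 else (1 - Real.cos (2 * π * u)) / (2 * π ^ 2 * u ^ 2)

/-- `∫₋₁¹ (1 - |y|) e(u y) dy = 𝔉(u)`. [folklore] -/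
theorem intervalIntegral_fejerKernelValue (u : ℝ) :
    ∫ y in (-1 : ℝ)..1, ((1 - |y| : ℝ) : ℂ) * Complex.exp (2 * π * I * u * y) =
      (fejerKernelValue u : ℂ) := by
  unfold fejerKernelValue
  split_ifs with hu
  · subst hu
    have e : (fun y : ℝ => ((1 - |y| : ℝ) : ℂ) * Complex.exp (2 * π * I * ((0 : ℝ) : ℂ) * y)) =
        fun y : ℝ => ((1 - |y| : ℝ) : ℂ) := by
      ext y
      simp
    rw [e, intervalIntegral.integral_ofReal, intervalIntegral_one_sub_abs, ofReal_one]
  · have hc : (2 * π * I * u : ℂ) ≠ 0 := by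
      have hπ : (π : ℂ) ≠ 0 := by exact_mod_cast Real.pi_ne_zero
      have hu' : (u : ℂ) ≠ 0 := by exact_mod_cast hu
      simp [hπ, hu', I_ne_zero]
    have key := intervalIntegral_fejer_cexp hc
    have e : (fun y : ℝ => ((1 - |y| : ℝ) : ℂ) * Complex.exp (2 * π * I * u * y)) =
        fun y : ℝ => ((1 - |y| : ℝ) : ℂ) * Complex.exp ((2 * π * I * u) * y) := by
      ext y; ring_nf
    rw [e, key]
    have hcos : Complex.exp (2 * π * I * u) + Complex.exp (-(2 * π * I * u)) =
        2 * (Real.cos (2 * π * u) : ℂ) := by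
      rw [Complex.ofReal_cos, Complex.two_cos]
      push_cast
      ring_nf
    rw [hcos]
    have hI : (2 * π * I * u : ℂ) ^ 2 = -(4 * π ^ 2 * u ^ 2) := by
      rw [mul_pow, mul_pow, mul_pow, I_sq]; ring
    rw [hI]
    have hden : (-(4 * π ^ 2 * u ^ 2) : ℂ) ≠ 0 := by
      rw [← hI]; exact pow_ne_zero 2 hc
    have hden' : ((2 * π ^ 2 * u ^ 2 : ℝ) : ℂ) ≠ 0 := by
      have hπ : (π : ℝ) ≠ 0 := Real.pi_ne_zero
      exact_mod_cast (by positivity : (2 * π ^ 2 * u ^ 2 : ℝ) ≠ 0)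
    push_cast at hden' ⊢
    rw [div_eq_div_iff hden hden']
    ring

/-- `𝔉(u) ≥ 0`. [folklore] -/
theorem fejerKernelValue_nonneg (u : ℝ) : 0 ≤ fejerKernelValue u := by
  unfold fejerKernelValue
  split_ifs with hu
  · norm_num
  · apply div_nonneg
    · linarith [Real.cos_le_one (2 * π * u)]
    · positivity

/-- `𝔉(u) ≥ 4/π²` for `|u| ≤ 1/2` (by Jordan's inequality `sin x ≥ (2/π) x` on `[0, π/2]`).
[folklore] -/
theorem fejerKernelValue_ge (u : ℝ) (hu : |u| ≤ 1 / 2) : 4 / π ^ 2 ≤ fejerKernelValue u := by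
  unfold fejerKernelValue
  split_ifs with h0
  · rw [div_le_one (by positivity)]
    nlinarith [Real.pi_gt_three]
  · have hcos : 1 - Real.cos (2 * π * u) = 2 * Real.sin (π * u) ^ 2 := by
      rw [show 2 * π * u = 2 * (π * u) by ring, Real.cos_two_mul, Real.cos_sq']
      ring
    rw [hcos]
    have key : ∀ v : ℝ, 0 ≤ v → v ≤ 1 / 2 → 2 * v ≤ Real.sin (π * v) := fun v hv0 hv => by
      have h2 : π * v ≤ π / 2 := by nlinarith [Real.pi_pos]
      have hj := Real.mul_le_sin (by positivity) h2
      calc 2 * v = 2 / π * (π * v) := by field_simp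
        _ ≤ Real.sin (π * v) := hj
    have hsq : 4 * u ^ 2 ≤ Real.sin (π * u) ^ 2 := by
      rcases le_or_gt 0 u with hu0 | hu0
      · have hk := key u hu0 (by rwa [abs_of_nonneg hu0] at hu)
        nlinarith [hk, mul_nonneg (sub_nonneg.2 hk)
          (by linarith : (0 : ℝ) ≤ Real.sin (π * u) + 2 * u)]
      · have hk := key (-u) (by linarith) (by rwa [abs_of_neg hu0] at hu)
        rw [show π * -u = -(π * u) by ring, Real.sin_neg] at hk
        nlinarith [hk, mul_nonneg (sub_nonneg.2 hk)
          (by linarith : (0 : ℝ) ≤ -Real.sin (π * u) + 2 * -u)]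
    have hu2 : 0 < u ^ 2 := lt_of_le_of_ne (sq_nonneg u) (Ne.symm (pow_ne_zero 2 h0))
    rw [div_le_div_iff₀ (by positivity) (by positivity)]
    nlinarith [mul_nonneg (sq_nonneg π) (sub_nonneg.2 hsq), Real.pi_pos]

/-! ### Fubini on a box for a product integrand -/

/-- Fubini for a product integrand on a box: `∫_{[a,b]} ∏ₖ gₖ(xₖ) dx = ∏ₖ ∫_{[aₖ,bₖ]} gₖ`.
[folklore] -/
theorem setIntegral_Icc_pi_prod {ι : Type*} [Fintype ι] (a b : ι → ℝ) (g : ι → ℝ → ℂ) :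
    ∫ x in Set.Icc a b, ∏ k, g k (x k) = ∏ k, ∫ y in Set.Icc (a k) (b k), g k y := by
  rw [← MeasureTheory.integral_indicator measurableSet_Icc]
  have key : (Set.Icc a b).indicator (fun x => ∏ k, g k (x k)) =
      fun x => ∏ k, (Set.Icc (a k) (b k)).indicator (g k) (x k) := by
    ext x
    by_cases hx : x ∈ Set.Icc a b
    · rw [Set.indicator_of_mem hx]
      refine Finset.prod_congr rfl fun k _ => ?_
      rw [Set.indicator_of_mem (show x k ∈ Set.Icc (a k) (b k) from ⟨hx.1 k, hx.2 k⟩)]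
    · rw [Set.indicator_of_notMem hx]
      have : ∃ k, x k ∉ Set.Icc (a k) (b k) := by
        by_contra hcon
        simp only [not_exists, not_not] at hcon
        exact hx ⟨fun k => (hcon k).1, fun k => (hcon k).2⟩
      obtain ⟨k, hk⟩ := this
      exact (Finset.prod_eq_zero (Finset.mem_univ k) (Set.indicator_of_notMem hk _)).symm
  rw [key, integral_fintype_prod_volume_eq_prod]
  refine Finset.prod_congr rfl fun k _ => ?_
  rw [MeasureTheory.integral_indicator measurableSet_Icc]

/-! ### The sixth power of the sum and the first spacing count -/

/-- The frequency vector of a six-tuple `h ∈ (0, H]⁶` in the normalisation of (2.28):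
`(∑ hⱼ, ∑ hⱼ², δ⁻¹ ∑ (hⱼ/H)^{3/2}, Δ⁻¹ ∑ (hⱼ/H)^{1/2})`, so that
`∑ⱼ φ(x, hⱼ) = ∑ₖ (freq h)ₖ xₖ` for the phase `φ` of `bourgainA6Sum`.
[cite: BourgainJAMS2017, §4 eq. (3.7)–(3.9)] -/
def bourgainSixFreq (H : ℕ) (δ Δ : ℝ) (h : Fin 6 → ℕ) : Fin 4 → ℝ :=
  ![∑ j, (h j : ℝ), ∑ j, (h j : ℝ) ^ 2, δ⁻¹ * ∑ j, ((h j : ℝ) / H) ^ (3 / 2 : ℝ),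
    Δ⁻¹ * ∑ j, ((h j : ℝ) / H) ^ (1 / 2 : ℝ)]

/-- `∑ⱼ φ(x, hⱼ) = ∑ₖ (freq h)ₖ xₖ`. [folklore] -/
theorem sum_bourgainA6Phase_eq (H : ℕ) (δ Δ : ℝ) (x : Fin 4 → ℝ) (h : Fin 6 → ℕ) :
    ∑ j, bourgainA6Phase H δ Δ x (h j) = ∑ k, bourgainSixFreq H δ Δ h k * x k := by
  simp only [bourgainA6Phase, bourgainSixFreq, Fin.sum_univ_four, Finset.sum_add_distrib,
    Matrix.cons_val_zero, Matrix.cons_val_one, Matrix.cons_val]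
  simp only [Finset.sum_mul, Finset.mul_sum]

/-- `S(x)⁶ = ∑_{h ∈ (0,H]⁶} e(∑ₖ (freq h)ₖ xₖ)`. [folklore] -/
theorem bourgainA6Sum_pow_six (H : ℕ) (δ Δ : ℝ) (x : Fin 4 → ℝ) :
    bourgainA6Sum H δ Δ x ^ 6 = ∑ h ∈ Fintype.piFinset (fun _ : Fin 6 => Finset.Icc 1 H),
      Complex.exp (2 * π * I * ↑(∑ k, bourgainSixFreq H δ Δ h k * x k)) := by
  unfold bourgainA6Sum
  rw [Finset.sum_pow']
  refine Finset.sum_congr rfl fun h _ => ?_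
  rw [← Complex.exp_sum, ← sum_bourgainA6Phase_eq]
  congr 1
  push_cast
  rw [Finset.mul_sum]

/-- `|S(x)|¹² = ∑_{h, h'} e(∑ₖ ((freq h)ₖ - (freq h')ₖ) xₖ)`. [folklore] -/
theorem norm_bourgainA6Sum_pow_twelve (H : ℕ) (δ Δ : ℝ) (x : Fin 4 → ℝ) :
    ((‖bourgainA6Sum H δ Δ x‖ ^ 12 : ℝ) : ℂ) =
      ∑ h ∈ Fintype.piFinset (fun _ : Fin 6 => Finset.Icc 1 H),
        ∑ h' ∈ Fintype.piFinset (fun _ : Fin 6 => Finset.Icc 1 H),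
          Complex.exp (2 * π * I *
            ↑(∑ k, (bourgainSixFreq H δ Δ h k - bourgainSixFreq H δ Δ h' k) * x k)) := by
  set S := bourgainA6Sum H δ Δ x with hS
  have h1 : ((‖S‖ ^ 12 : ℝ) : ℂ) = S ^ 6 * (starRingEnd ℂ) (S ^ 6) := by
    rw [Complex.mul_conj, Complex.normSq_eq_norm_sq, norm_pow, ← pow_mul]
  rw [h1, hS, bourgainA6Sum_pow_six, map_sum, Finset.sum_mul_sum]
  refine Finset.sum_congr rfl fun h _ => Finset.sum_congr rfl fun h' _ => ?_
  rw [← Complex.exp_conj, ← Complex.exp_add]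
  congr 1
  have e : ∑ k, (bourgainSixFreq H δ Δ h k - bourgainSixFreq H δ Δ h' k) * x k =
      ∑ k, bourgainSixFreq H δ Δ h k * x k - ∑ k, bourgainSixFreq H δ Δ h' k * x k := by
    rw [← Finset.sum_sub_distrib]
    refine Finset.sum_congr rfl fun k _ => by ring
  rw [e]
  simp only [map_mul, Complex.conj_ofReal, Complex.conj_I, map_ofNat]
  push_cast
  ring

/-- The weighted box integral of one exponential: with the weight `(1 - |x₃|)(1 - |x₄|)`,
`∫_{[0,1]²×[-1,1]²} (1 - |x₃|)(1 - |x₄|) e(t·x) dx = (∫₀¹ e(t₁y)dy)(∫₀¹ e(t₂y)dy) 𝔉(t₃) 𝔉(t₄)`.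
[folklore] -/
theorem setIntegral_box_weight_cexp (t : Fin 4 → ℝ) :
    ∫ x in bourgainA6Box, (((1 - |x 2|) * (1 - |x 3|) : ℝ) : ℂ) *
        Complex.exp (2 * π * I * ↑(∑ k, t k * x k)) =
      (∫ y in (0 : ℝ)..1, Complex.exp (2 * π * I * (t 0) * y)) *
        (∫ y in (0 : ℝ)..1, Complex.exp (2 * π * I * (t 1) * y)) *
        (fejerKernelValue (t 2)) * (fejerKernelValue (t 3)) := by
  -- the one-dimensional factors
  let w : Fin 4 → ℝ → ℝ := ![fun _ => 1, fun _ => 1, fun y => 1 - |y|, fun y => 1 - |y|]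
  let g : Fin 4 → ℝ → ℂ := fun k y => (w k y : ℂ) * Complex.exp (2 * π * I * (t k) * y)
  have hw0 : w 0 = fun _ => 1 := rfl
  have hw1 : w 1 = fun _ => 1 := rfl
  have hw2 : w 2 = fun y => 1 - |y| := rfl
  have hw3 : w 3 = fun y => 1 - |y| := rfl
  have hprod : ∀ x : Fin 4 → ℝ, (((1 - |x 2|) * (1 - |x 3|) : ℝ) : ℂ) *
      Complex.exp (2 * π * I * ↑(∑ k, t k * x k)) = ∏ k, g k (x k) := by
    intro x
    simp only [g, Finset.prod_mul_distrib, ← Complex.exp_sum]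
    congr 1
    · simp [Fin.prod_univ_four, hw0, hw1, hw2, hw3]
    · have e : (2 * ↑π * I * ↑(∑ k, t k * x k) : ℂ) = ∑ k, 2 * ↑π * I * ↑(t k) * ↑(x k) := by
        rw [Complex.ofReal_sum, Finset.mul_sum]
        exact Finset.sum_congr rfl fun k _ => by push_cast; ring
      rw [e]
  simp_rw [hprod]
  unfold bourgainA6Box
  rw [setIntegral_Icc_pi_prod]
  simp only [Fin.prod_univ_four, Matrix.cons_val_zero, Matrix.cons_val_one, Matrix.cons_val]
  -- convert the four set integrals to interval integrals
  have hIcc : ∀ (a b : ℝ) (hab : a ≤ b) (f : ℝ → ℂ),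
      ∫ y in Set.Icc a b, f y = ∫ y in a..b, f y := by
    intro a b hab f
    rw [integral_Icc_eq_integral_Ioc, intervalIntegral.integral_of_le hab]
  rw [hIcc _ _ (by norm_num), hIcc _ _ (by norm_num), hIcc (-1) 1 (by norm_num),
    hIcc (-1) 1 (by norm_num)]
  simp only [g, hw0, hw1, hw2, hw3, ofReal_one, one_mul]
  rw [intervalIntegral_fejerKernelValue (t 2), intervalIntegral_fejerKernelValue (t 3)]

/-- The pair weight `r(h, h') = [∑hⱼ = ∑h'ⱼ] [∑hⱼ² = ∑h'ⱼ²] 𝔉(t₃) 𝔉(t₄)`, `t = freq h - freq h'`.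
[folklore] -/
def bourgainPairWeight (H : ℕ) (δ Δ : ℝ) (h h' : Fin 6 → ℕ) : ℝ :=
  (if ∑ j, (h j : ℤ) = ∑ j, (h' j : ℤ) then 1 else 0) *
    (if ∑ j, (h j : ℤ) ^ 2 = ∑ j, (h' j : ℤ) ^ 2 then 1 else 0) *
    fejerKernelValue (bourgainSixFreq H δ Δ h 2 - bourgainSixFreq H δ Δ h' 2) *
    fejerKernelValue (bourgainSixFreq H δ Δ h 3 - bourgainSixFreq H δ Δ h' 3)

/-- The pair weight is non-negative. [folklore] -/
theorem bourgainPairWeight_nonneg (H : ℕ) (δ Δ : ℝ) (h h' : Fin 6 → ℕ) :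
    0 ≤ bourgainPairWeight H δ Δ h h' := by
  unfold bourgainPairWeight
  refine mul_nonneg (mul_nonneg (mul_nonneg ?_ ?_) (fejerKernelValue_nonneg _))
    (fejerKernelValue_nonneg _) <;>
  split_ifs <;> norm_num

/-- The weighted box integral of the `(h, h')` term is the pair weight. [folklore] -/
theorem setIntegral_box_weight_pair (H : ℕ) (δ Δ : ℝ) (h h' : Fin 6 → ℕ) :
    ∫ x in bourgainA6Box, (((1 - |x 2|) * (1 - |x 3|) : ℝ) : ℂ) *
        Complex.exp (2 * π * I *
          ↑(∑ k, (bourgainSixFreq H δ Δ h k - bourgainSixFreq H δ Δ h' k) * x k)) =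
      (bourgainPairWeight H δ Δ h h' : ℂ) := by
  rw [setIntegral_box_weight_cexp (fun k => bourgainSixFreq H δ Δ h k - bourgainSixFreq H δ Δ h' k)]
  unfold bourgainPairWeight
  have h0 : bourgainSixFreq H δ Δ h 0 - bourgainSixFreq H δ Δ h' 0 =
      ((∑ j, (h j : ℤ) - ∑ j, (h' j : ℤ) : ℤ) : ℝ) := by
    simp [bourgainSixFreq]
  have h1 : bourgainSixFreq H δ Δ h 1 - bourgainSixFreq H δ Δ h' 1 =
      ((∑ j, (h j : ℤ) ^ 2 - ∑ j, (h' j : ℤ) ^ 2 : ℤ) : ℝ) := by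
    simp [bourgainSixFreq]
  simp only [h0, h1, Complex.ofReal_intCast, intervalIntegral_cexp_two_pi_mul_int, sub_eq_zero]
  push_cast
  split_ifs <;> simp

/-- The first spacing count of Bourgain's §4 in the normalisation of (2.28): the number `A` of
pairs `(h, h') ∈ ((0, H]⁶)²` with `|y₁(h) - y₁(h')| < 1`, `|y₂(h) - y₂(h')| < 1`,
`|∑ (hⱼ/H)^{3/2} - ∑ (h'ⱼ/H)^{3/2}| < δ/2`, `|∑ (hⱼ/H)^{1/2} - ∑ (h'ⱼ/H)^{1/2}| < Δ/2`, where
`y(h) = ∑ⱼ (hⱼ, hⱼ², hⱼ^{3/2}, hⱼ^{1/2})`. With `X₁ = X₂ = 1/2`, `X₃ = X₄ = δ⁻¹ H^{-3/2}` and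
`Δ = Hδ` these are exactly the printed conditions `|yⱼ(h) - yⱼ(h')| < 1/(2Xⱼ)` (`j ≤ 4`) defining
`A` after (3.9) (there `δ = Q²/(H²R²)`, `X₃ = X₄ = (R/Q)² H^{1/2}`).
[cite: BourgainJAMS2017, §4, the definition of `A` after eq. (3.9)] -/
def bourgainFirstSpacingCount (H : ℕ) (δ Δ : ℝ) : ℕ :=
  ((Fintype.piFinset (fun _ : Fin 6 => Finset.Icc 1 H) ×ˢ
      Fintype.piFinset (fun _ : Fin 6 => Finset.Icc 1 H)).filter fun p =>
    |∑ j, (p.1 j : ℝ) - ∑ j, (p.2 j : ℝ)| < 1 ∧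
    |∑ j, (p.1 j : ℝ) ^ 2 - ∑ j, (p.2 j : ℝ) ^ 2| < 1 ∧
    |∑ j, ((p.1 j : ℝ) / H) ^ (3 / 2 : ℝ) - ∑ j, ((p.2 j : ℝ) / H) ^ (3 / 2 : ℝ)| < δ / 2 ∧
    |∑ j, ((p.1 j : ℝ) / H) ^ (1 / 2 : ℝ) - ∑ j, ((p.2 j : ℝ) / H) ^ (1 / 2 : ℝ)| < Δ / 2).card

/-- For a close pair the pair weight is at least `16/π⁴`. [folklore] -/
theorem bourgainPairWeight_ge {H : ℕ} {δ Δ : ℝ} (hδ : 0 < δ) (hΔ : 0 < Δ) {h h' : Fin 6 → ℕ}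
    (h0 : |∑ j, (h j : ℝ) - ∑ j, (h' j : ℝ)| < 1)
    (h1 : |∑ j, (h j : ℝ) ^ 2 - ∑ j, (h' j : ℝ) ^ 2| < 1)
    (h2 : |∑ j, ((h j : ℝ) / H) ^ (3 / 2 : ℝ) - ∑ j, ((h' j : ℝ) / H) ^ (3 / 2 : ℝ)| < δ / 2)
    (h3 : |∑ j, ((h j : ℝ) / H) ^ (1 / 2 : ℝ) - ∑ j, ((h' j : ℝ) / H) ^ (1 / 2 : ℝ)| < Δ / 2) :
    16 / π ^ 4 ≤ bourgainPairWeight H δ Δ h h' := by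
  unfold bourgainPairWeight
  have e0 : ∑ j, (h j : ℤ) = ∑ j, (h' j : ℤ) := by
    have hcast : ((∑ j, (h j : ℤ) - ∑ j, (h' j : ℤ) : ℤ) : ℝ) =
        ∑ j, (h j : ℝ) - ∑ j, (h' j : ℝ) := by
      norm_cast
    have hlt : |((∑ j, (h j : ℤ) - ∑ j, (h' j : ℤ) : ℤ) : ℝ)| < 1 := by rw [hcast]; exact h0
    rw [← Int.cast_abs] at hlt
    have hint : |∑ j, (h j : ℤ) - ∑ j, (h' j : ℤ)| < 1 := by exact_mod_cast hlt
    have := abs_lt.1 hint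
    omega
  have e1 : ∑ j, (h j : ℤ) ^ 2 = ∑ j, (h' j : ℤ) ^ 2 := by
    have hcast : ((∑ j, (h j : ℤ) ^ 2 - ∑ j, (h' j : ℤ) ^ 2 : ℤ) : ℝ) =
        ∑ j, (h j : ℝ) ^ 2 - ∑ j, (h' j : ℝ) ^ 2 := by
      norm_cast
    have hlt : |((∑ j, (h j : ℤ) ^ 2 - ∑ j, (h' j : ℤ) ^ 2 : ℤ) : ℝ)| < 1 := by rw [hcast]; exact h1
    rw [← Int.cast_abs] at hlt
    have hint : |∑ j, (h j : ℤ) ^ 2 - ∑ j, (h' j : ℤ) ^ 2| < 1 := by exact_mod_cast hlt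
    have := abs_lt.1 hint
    omega
  rw [if_pos e0, if_pos e1, one_mul, one_mul]
  have f2 : 4 / π ^ 2 ≤
      fejerKernelValue (bourgainSixFreq H δ Δ h 2 - bourgainSixFreq H δ Δ h' 2) := by
    apply fejerKernelValue_ge
    have e : bourgainSixFreq H δ Δ h 2 - bourgainSixFreq H δ Δ h' 2 =
        δ⁻¹ * (∑ j, ((h j : ℝ) / H) ^ (3 / 2 : ℝ) - ∑ j, ((h' j : ℝ) / H) ^ (3 / 2 : ℝ)) := by
      simp [bourgainSixFreq]; ring
    rw [e, abs_mul, abs_of_pos (inv_pos.2 hδ)]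
    rw [inv_mul_le_iff₀ hδ]
    linarith
  have f3 : 4 / π ^ 2 ≤
      fejerKernelValue (bourgainSixFreq H δ Δ h 3 - bourgainSixFreq H δ Δ h' 3) := by
    apply fejerKernelValue_ge
    have e : bourgainSixFreq H δ Δ h 3 - bourgainSixFreq H δ Δ h' 3 =
        Δ⁻¹ * (∑ j, ((h j : ℝ) / H) ^ (1 / 2 : ℝ) - ∑ j, ((h' j : ℝ) / H) ^ (1 / 2 : ℝ)) := by
      simp [bourgainSixFreq]; ring
    rw [e, abs_mul, abs_of_pos (inv_pos.2 hΔ)]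
    rw [inv_mul_le_iff₀ hΔ]
    linarith
  have hπ : 0 < 4 / π ^ 2 := by positivity
  calc 16 / π ^ 4 = (4 / π ^ 2) * (4 / π ^ 2) := by ring
    _ ≤ _ := mul_le_mul f2 f3 hπ.le ((hπ.le).trans f2)


/-- Counting by a weighted sum: if `f ≥ 0` on `s` and `f ≥ c` on the elements of `s` satisfying
`p`, then `#{a ∈ s | p a} · c ≤ ∑_{a ∈ s} f a`. [folklore] -/
theorem card_filter_mul_le_sum {α : Type*} (s : Finset α) (p : α → Prop) {_ : DecidablePred p}
    (f : α → ℝ) (c : ℝ) (hf : ∀ a ∈ s, 0 ≤ f a) (hp : ∀ a ∈ s, p a → c ≤ f a) :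
    ((s.filter p).card : ℝ) * c ≤ ∑ a ∈ s, f a := by
  calc ((s.filter p).card : ℝ) * c = ∑ _a ∈ s.filter p, c := by
        rw [Finset.sum_const, nsmul_eq_mul]
    _ ≤ ∑ a ∈ s.filter p, f a :=
        Finset.sum_le_sum fun a ha => hp a (Finset.mem_filter.1 ha).1 (Finset.mem_filter.1 ha).2
    _ ≤ ∑ a ∈ s, f a :=
        Finset.sum_le_sum_of_subset_of_nonneg (Finset.filter_subset p s) fun a ha _ => hf a ha

/-- **The first spacing count is dominated by the mean value `A₆`** (Bourgain's use of
[H] Lemma 5.6.5 on p. 11 of the paper, here with the constant `π⁴/16`):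
`A ≤ (π⁴/16) A₆(H; δ, Δ)` for `δ, Δ > 0`, where `A = bourgainFirstSpacingCount H δ Δ` and
`A₆ = bourgainA6 H δ Δ` is the twelfth moment (2.28). Proof: insert the weight
`(1 - |x₃|)(1 - |x₄|) ≤ 1` in `A₆ = ∫_{[0,1]²×[-1,1]²} |S|¹²`, expand `|S|¹² = |S⁶|²` as a double
sum over `(h, h') ∈ ((0,H]⁶)²` of `e((freq h - freq h')·x)`, and integrate: the integer
frequencies in `x₁, x₂` give orthogonality factors `[∑hⱼ = ∑h'ⱼ][∑hⱼ² = ∑h'ⱼ²] ≥ 0`, the real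
frequencies in `x₃, x₄` give Fejér factors `𝔉 ≥ 0`, and for a close pair all four factors are
`≥ 1, 1, 4/π², 4/π²`. [cite: BourgainJAMS2017, §4, display before eq. (3.10)] -/
theorem bourgainFirstSpacingCount_le (H : ℕ) {δ Δ : ℝ} (hδ : 0 < δ) (hΔ : 0 < Δ) :
    (bourgainFirstSpacingCount H δ Δ : ℝ) ≤ π ^ 4 / 16 * bourgainA6 H δ Δ := by
  set V := Fintype.piFinset (fun _ : Fin 6 => Finset.Icc 1 H) with hV
  -- every continuous function is integrable on the box
  have hint : ∀ f : (Fin 4 → ℝ) → ℂ, Continuous f →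
      Integrable f (volume.restrict bourgainA6Box) := fun f hf => by
    have : IntegrableOn f bourgainA6Box volume := by
      unfold bourgainA6Box
      exact hf.continuousOn.integrableOn_compact isCompact_Icc
    exact this
  -- Step 1: the weighted integral is the double sum of the pair weights
  have step1 : ∫ x in bourgainA6Box, (1 - |x 2|) * (1 - |x 3|) * ‖bourgainA6Sum H δ Δ x‖ ^ 12 =
      ∑ h ∈ V, ∑ h' ∈ V, bourgainPairWeight H δ Δ h h' := by
    apply Complex.ofReal_injective
    rw [← integral_complex_ofReal]
    simp_rw [Complex.ofReal_mul, norm_bourgainA6Sum_pow_twelve, Finset.mul_sum]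
    rw [integral_finsetSum _ (fun h _ => ?_)]
    · push_cast
      refine Finset.sum_congr rfl fun h _ => ?_
      rw [integral_finsetSum _ (fun h' _ => ?_)]
      · refine Finset.sum_congr rfl fun h' _ => ?_
        have key := setIntegral_box_weight_pair H δ Δ h h'
        push_cast at key ⊢
        exact key
      · exact hint _ (by fun_prop)
    · exact hint _ (by fun_prop)
  -- Step 2: the double sum dominates the count
  have step2 : (bourgainFirstSpacingCount H δ Δ : ℝ) * (16 / π ^ 4) ≤
      ∑ h ∈ V, ∑ h' ∈ V, bourgainPairWeight H δ Δ h h' := by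
    rw [← Finset.sum_product']
    unfold bourgainFirstSpacingCount
    refine card_filter_mul_le_sum _ _ _ _ (fun q _ => bourgainPairWeight_nonneg H δ Δ q.1 q.2)
      fun q _ hq => ?_
    exact bourgainPairWeight_ge hδ hΔ hq.1 hq.2.1 hq.2.2.1 hq.2.2.2
  -- Step 3: the weighted integral is at most `A₆`
  have step3 : ∫ x in bourgainA6Box, (1 - |x 2|) * (1 - |x 3|) * ‖bourgainA6Sum H δ Δ x‖ ^ 12 ≤
      bourgainA6 H δ Δ := by
    rw [bourgainA6_def]
    refine setIntegral_mono_on ?_ (integrableOn_bourgainA6_integrand H δ Δ)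
      (by unfold bourgainA6Box; exact measurableSet_Icc) fun x hx => ?_
    · unfold bourgainA6Box
      exact (Continuous.continuousOn (by
        have := continuous_bourgainA6Sum H δ Δ
        fun_prop)).integrableOn_compact isCompact_Icc
    · unfold bourgainA6Box at hx
      have h2l : -1 ≤ x 2 := by have := hx.1 2; simpa using this
      have h2u : x 2 ≤ 1 := by have := hx.2 2; simpa using this
      have h3l : -1 ≤ x 3 := by have := hx.1 3; simpa using this
      have h3u : x 3 ≤ 1 := by have := hx.2 3; simpa using this
      have hw0 : 0 ≤ 1 - |x 2| := by rw [sub_nonneg, abs_le]; exact ⟨h2l, h2u⟩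
      have hw1 : 1 - |x 2| ≤ 1 := by linarith [abs_nonneg (x 2)]
      have hw0' : 0 ≤ 1 - |x 3| := by rw [sub_nonneg, abs_le]; exact ⟨h3l, h3u⟩
      have hw1' : 1 - |x 3| ≤ 1 := by linarith [abs_nonneg (x 3)]
      have hS : 0 ≤ ‖bourgainA6Sum H δ Δ x‖ ^ 12 := by positivity
      calc (1 - |x 2|) * (1 - |x 3|) * ‖bourgainA6Sum H δ Δ x‖ ^ 12
          ≤ 1 * 1 * ‖bourgainA6Sum H δ Δ x‖ ^ 12 := by
            apply mul_le_mul_of_nonneg_right _ hS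
            exact mul_le_mul hw1 hw1' hw0' zero_le_one
        _ = ‖bourgainA6Sum H δ Δ x‖ ^ 12 := by ring
  -- conclusion
  have key : (bourgainFirstSpacingCount H δ Δ : ℝ) * (16 / π ^ 4) ≤ bourgainA6 H δ Δ :=
    step2.trans (step1 ▸ step3)
  have hπ : (0 : ℝ) < π ^ 4 / 16 := by positivity
  calc (bourgainFirstSpacingCount H δ Δ : ℝ)
      = (bourgainFirstSpacingCount H δ Δ : ℝ) * (16 / π ^ 4) * (π ^ 4 / 16) := by
        field_simp
    _ ≤ bourgainA6 H δ Δ * (π ^ 4 / 16) := mul_le_mul_of_nonneg_right key hπ.le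
    _ = π ^ 4 / 16 * bourgainA6 H δ Δ := mul_comm _ _

/-- **Bourgain 2017, eq. (3.10), for the first spacing count**: given Corollary 3 (2.28) of the
paper (hypothesis `h`, written out explicitly as in `Bourgain2017_eq310_of_corollary3`:
`A₆(N, δ, Δ) ≤ C(ε) δ Δ N^{9+ε}` for `N ≥ 1`, `1/N² ≤ δ ≤ 1`, `1/N ≤ Δ ≤ 1`), for every `ε > 0`
there is `C` with `A ≤ C δ² H^{10+ε}` whenever `H ≥ 1` and `1/H² ≤ δ ≤ 1/H` (i.e.
`1/H ≤ Hδ ≤ 1`), where `A = bourgainFirstSpacingCount H δ (Hδ)` is the first spacing count of the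
double large sieve in §4 ("it is a corollary of [H], Lemma 5.6.5 (for example) that we have here
`0 ≤ A ≤ … = (π⁸/4) A₆(H; δ, Hδ)` … Therefore it follows by Corollary 3 that we have
`A ≪ δ² H^{10+ε}` (3.10)"). [cite: BourgainJAMS2017, §4 eq. (3.10); Corollary 3, eq. (2.28)] -/
theorem Bourgain2017_eq310_count_of_corollary3
    (h : ∀ ε : ℝ, 0 < ε → ∃ C : ℝ, ∀ N : ℕ, 1 ≤ N → ∀ δ Δ : ℝ,
      1 / (N : ℝ) ^ 2 ≤ δ → δ ≤ 1 → 1 / (N : ℝ) ≤ Δ → Δ ≤ 1 →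
        bourgainA6 N δ Δ ≤ C * δ * Δ * (N : ℝ) ^ (9 + ε))
    {ε : ℝ} (hε : 0 < ε) :
    ∃ C : ℝ, ∀ H : ℕ, 1 ≤ H → ∀ δ : ℝ, 1 / (H : ℝ) ^ 2 ≤ δ → δ ≤ 1 / H →
      (bourgainFirstSpacingCount H δ (H * δ) : ℝ) ≤ C * δ ^ 2 * (H : ℝ) ^ (10 + ε) := by
  obtain ⟨C, hC⟩ := Bourgain2017_eq310_of_corollary3 h hε
  refine ⟨π ^ 4 / 16 * C, fun H hH δ hδl hδu => ?_⟩
  have hHpos : (0 : ℝ) < H := by exact_mod_cast hH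
  have hδ : 0 < δ := lt_of_lt_of_le (by positivity) hδl
  have hΔ : 0 < (H : ℝ) * δ := mul_pos hHpos hδ
  calc (bourgainFirstSpacingCount H δ (H * δ) : ℝ) ≤ π ^ 4 / 16 * bourgainA6 H δ (H * δ) :=
        bourgainFirstSpacingCount_le H hδ hΔ
    _ ≤ π ^ 4 / 16 * (C * δ ^ 2 * (H : ℝ) ^ (10 + ε)) :=
        mul_le_mul_of_nonneg_left (hC H hH δ hδl hδu) (by positivity)
    _ = π ^ 4 / 16 * C * δ ^ 2 * (H : ℝ) ^ (10 + ε) := by ring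

end Literature.NumberTheory.LFunctions
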